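import Literature.AnabelianGeometry.SemiGraphs.PSCSmoothCurveGenuineSturdy
import Literature.AnabelianGeometry.SemiGraphs.PSCSmoothCurveGenuineOrigin
import Literature.AnabelianGeometry.SemiGraphs.PSCThm16iiiAssemblyPrimeProofs
import HarnessLib

/-!
# The pro-`ℓ` genuine smooth-curve origin: the [CombGC] §1 / [IUTchI] Rmk. 1.2.3 input family holds jointly

Mochizuki, *A combinatorial version of the Grothendieck conjecture* [CombGC], Tohoku Math. J. **59**
(2007), §1 pp. 6–14 (Def. 1.1 (i)(ii), Rmk. 1.1.3, Rmk. 1.1.5, Prop. 1.2 (i)(ii) and its proof p. 9,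
Prop. 1.5 (i)(ii), Thm. 1.6 (iii)); [IUTchI] Rmk. 1.2.3 (iv) p. 42.
[cite: MochizukiCombGC2007, §1 pp.6-14] [cite: Mochizuki2012, IUTchI Rmk 1.2.3(iv) p.42]

PROOF-ONLY assembly (abc-iut cell, layer L3, [CombGC] non-vacuity programme; seat abc-iut-w5-d195 gen 7,
brick «SC-GENUINE-COVERING-CLOSED», part F).  The printed statements of [CombGC] §1 are typed as
schemata `…Holds Ω` over an origin parameter `Ω : PSCOrigin`; the tree's derivations of Thm. 1.6 (iii) /
[IUTchI] Rmk. 1.2.3 (iv) (`unrVerticialIff_holds_of_inputs'`, `vertexSetCharacterizationHolds_of_profiniteOrigin'`)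
and of Prop. 1.2 take several of them as origin-level INPUTS, and all are stated for `Σ = {ℓ}`.  Here ONE
origin carries them jointly at GENUINE data WITH CUSPS: `Ω_scg^{(ℓ)}` = data over a profinite group with
one vertex `Π_v = Π`, no nodes, `Σ = {ℓ}` for some prime `ℓ`, a pro-`ℓ` completion `ι : Γ_{g,r} → Π` of a
hyperbolic punctured surface group, `genus(v) = g`, a bijection `e : cusps ≃ Fin r`, and cusp groups ANY
representatives `δ_c · closure ι⟨c_{e c}⟩ · δ_c⁻¹` of the cuspidal conjugacy classes
(`exists_smoothCurveGenuineProLOrigin_inputs_hold`):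

* INHABITED by the pro-`ℓ` completion of every smooth hyperbolic curve type `(g, r)` and every prime `ℓ`
  (`IsProSigmaCompletion.exists_isProSigmaCompletion`; e.g. the pro-`ℓ` tripod);
* **`RestrictBDOfPSCTypeHolds`** (Def. 1.1 (ii), covering-closed: `restrict_smoothCurveGenuine`) and every
  datum profinite;
* **`SturdyCoverHolds`** (Rmk. 1.1.5, both sentences: `sturdyCoverHolds_of_smoothCurveGenuine_singleton`),
  **`UnrVertAbOfRankHolds`** (Rmk. 1.1.5 rank `2g`), **`UnrVerticialCharacterizationHolds'`** ([IUTchI]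
  Rmk. 1.2.3 (iv), corrected), **`VertCountLeNodeCountSuccHolds`** (Rmk. 1.1.3), and their consequence
  **`VertexSetCharacterizationHolds`** (abc-iut-f-166 / -w4-d052's `vertexSetCharacterizationHolds_of_profiniteOrigin'`);
* F-2830 `SeparatingCoveringsHolds`, F-0438 `CommensurableTerminalityHolds`, F-0459
  `OpenInterDeterminesComponentHolds`, F-0440 `EdgeLikeIncidenceHolds`, F-0461 `UnrVerticialIffHolds`,
  F-0443 `GraphicIffEdgeLikeVerticialHolds`.

Of the origin-level inputs of `unrVerticialIff_holds_of_inputs'` only `RankStatementsHold` (Rmk. 1.1.3/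
1.3.1 ranks at every level) is not witnessed here.  HONEST SCOPE: `Σ = {ℓ}` because the typed
"characteristic" of Rmk. 1.1.5 is Mathlib's abstract `Subgroup.Characteristic` (continuity of abstract
automorphisms = Serre's theorem, pro-`ℓ`); consistency / non-vacuity evidence at genuine one-component
data, not the printed theorems for all pointed stable curves; 0 definitions; nothing here takes a side on
[IUTchIII] Cor. 3.12.
-/

noncomputable section

namespace Literature.AnabelianGeometry.SemiGraphs

namespace PSCDatum

open scoped Pointwise
open Literature.GroupTheory.CombinatorialGroupTheory
open Literature.GroupTheory.CombinatorialGroupTheory.PuncturedSurfaceGroup (cuspInertia IsHyperbolicType)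
open SemiGraphOfAnabelioids (IsProSigmaCompletion)
open SemiGraphOfAnabelioids.IsProSigmaCompletion (exists_isProSigmaCompletion)

/-- **The pro-`ℓ` GENUINE smooth-curve origin carries the [CombGC] §1 / [IUTchI] Rmk. 1.2.3 (iv) input
family jointly, and is inhabited by every hyperbolic `(g, r)` and every prime `ℓ`.**  Let `Ω` declare
"of PSC-type" exactly the data over a PROFINITE group with no nodes, one vertex with `Π_v = Π`, `Σ = {ℓ}`
(`ℓ` prime), a pro-`Σ` completion `ι : Γ_{g,r} → Π` of a hyperbolic punctured surface group with
`genus(v) = g`, a bijection `e : cusps ≃ Fin r`, and cusp groups conjugates `δ_c closure(ι⟨c_{e c}⟩) δ_c⁻¹`.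
Then `Ω` contains, for all hyperbolic `(g, r)` and primes `ℓ`, the datum of the pro-`ℓ` smooth curve of
type `(g, r)` (`Π` = the pro-`ℓ` completion of `Γ_{g,r}`, one vertex of genus `g`, `r` cusps);
`RestrictBDOfPSCTypeHolds Ω`; every `Ω`-datum is profinite; and `SturdyCoverHolds Ω`,
`UnrVertAbOfRankHolds Ω`, `UnrVerticialCharacterizationHolds' Ω`, `VertCountLeNodeCountSuccHolds Ω`,
`VertexSetCharacterizationHolds Ω`, `SeparatingCoveringsHolds Ω`, `CommensurableTerminalityHolds Ω`,
`OpenInterDeterminesComponentHolds Ω`, `EdgeLikeIncidenceHolds Ω`, `UnrVerticialIffHolds Ω`,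
`GraphicIffEdgeLikeVerticialHolds Ω` all hold.  Non-vacuity evidence at genuine data with cusps and all
their finite étale coverings; not the printed theorems for all pointed stable curves.
[cite: MochizukiCombGC2007, Rmk 1.1.5 p.8] -/
theorem exists_smoothCurveGenuineProLOrigin_inputs_hold :
    ∃ Ω : PSCOrigin.{0},
      (∀ (g r ℓ : ℕ), IsHyperbolicType g r → ℓ.Prime →
        ∃ (Q : ProfiniteGrp.{0}) (ι : PuncturedSurfaceGroup g r →* Q) (G : PSCDatum Q),
          IsProSigmaCompletion {ℓ} ι ∧ Ω.IsOfPSCType G ∧ G.Sigma = {ℓ} ∧ G.graph.i = 1 ∧ G.graph.n = 0 ∧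
            G.graph.r = r ∧ (∀ v, G.vertGp v = ⊤ ∧ G.genus v = g) ∧
            ∃ e : G.graph.C ≃ Fin r, ∀ c, G.cuspGp c =
              ((cuspInertia (g := g) (e c)).map ι).topologicalClosure) ∧
      RestrictBDOfPSCTypeHolds Ω ∧
      (∀ ⦃Q : Type⦄ [Group Q] [TopologicalSpace Q] [IsTopologicalGroup Q] (G : PSCDatum Q),
        Ω.IsOfPSCType G → CompactSpace Q ∧ T2Space Q ∧ TotallyDisconnectedSpace Q ∧ IsEmpty G.graph.N ∧
          (∀ v, G.vertGp v = ⊤) ∧ (∃ v₀ : G.graph.V, ∀ w, w = v₀) ∧ ∃ ℓ : ℕ, ℓ.Prime ∧ G.Sigma = {ℓ}) ∧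
      SturdyCoverHolds Ω ∧ UnrVertAbOfRankHolds Ω ∧ UnrVerticialCharacterizationHolds' Ω ∧
      VertCountLeNodeCountSuccHolds Ω ∧ VertexSetCharacterizationHolds Ω ∧
      SeparatingCoveringsHolds Ω ∧ CommensurableTerminalityHolds Ω ∧ OpenInterDeterminesComponentHolds Ω ∧
      EdgeLikeIncidenceHolds Ω ∧ UnrVerticialIffHolds Ω ∧ GraphicIffEdgeLikeVerticialHolds Ω := by
  let Ω : PSCOrigin.{0} :=
    ⟨fun {Q} _ _ G => ∃ (_ : IsTopologicalGroup Q), CompactSpace Q ∧ T2Space Q ∧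
      TotallyDisconnectedSpace Q ∧ IsEmpty G.graph.N ∧ (∀ v, G.vertGp v = ⊤) ∧
      (∃ v₀ : G.graph.V, ∀ w, w = v₀) ∧ (∃ ℓ : ℕ, ℓ.Prime ∧ G.Sigma = {ℓ}) ∧
      ∃ (g r : ℕ) (ι : PuncturedSurfaceGroup g r →* Q) (e : G.graph.C ≃ Fin r),
        IsHyperbolicType g r ∧ IsProSigmaCompletion G.Sigma ι ∧ (∀ v, G.genus v = g) ∧
        ∀ c, ∃ δ : ConjAct Q, G.cuspGp c = δ • ((cuspInertia (g := g) (e c)).map ι).topologicalClosure⟩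
  -- the hypothesis shapes of the parametric instance forms, read off `Ω`
  have hΩ₁ : ∀ ⦃Q : Type⦄ [Group Q] [TopologicalSpace Q] [IsTopologicalGroup Q] (G : PSCDatum Q),
      Ω.IsOfPSCType G → CompactSpace Q ∧ T2Space Q ∧ TotallyDisconnectedSpace Q ∧ IsEmpty G.graph.N ∧
        (∀ v, G.vertGp v = ⊤) ∧ (∃ v₀ : G.graph.V, ∀ w, w = v₀) ∧
        ∃ (S : Set ℕ) (g r : ℕ) (ι : PuncturedSurfaceGroup g r →* Q) (e : G.graph.C ≃ Fin r),
          S.Nonempty ∧ (∀ p ∈ S, p.Prime) ∧ IsHyperbolicType g r ∧ IsProSigmaCompletion S ι ∧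
          ∀ c, ∃ δ : ConjAct Q, G.cuspGp c =
            δ • ((cuspInertia (g := g) (e c)).map ι).topologicalClosure := by
    intro Q _ _ _ G hG
    obtain ⟨_, hc, ht, hd, hN, hV, hv, -, g, r, ι, e, hgr, hι, -, hC⟩ := hG
    exact ⟨hc, ht, hd, hN, hV, hv, G.Sigma, g, r, ι, e, G.sigma_nonempty, G.sigma_prime, hgr, hι, hC⟩
  have hΩ₂ : ∀ ⦃Q : Type⦄ [Group Q] [TopologicalSpace Q] (G : PSCDatum Q), Ω.IsOfPSCType G →
      IsEmpty G.graph.N ∧ (∀ v, G.vertGp v = ⊤) ∧ Nonempty G.graph.V := by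
    intro Q _ _ G hG
    obtain ⟨_, -, -, -, hN, hV, ⟨v₀, -⟩, -⟩ := hG
    exact ⟨hN, hV, ⟨v₀⟩⟩
  have hΩv : ∀ ⦃Q : Type⦄ [Group Q] [TopologicalSpace Q] (G : PSCDatum Q), Ω.IsOfPSCType G →
      (∀ v, G.vertGp v = ⊤) ∧ ∃ v₀ : G.graph.V, ∀ w, w = v₀ := by
    intro Q _ _ G hG
    obtain ⟨_, -, -, -, -, hV, hv, -⟩ := hG
    exact ⟨hV, hv⟩
  have hprof : ∀ ⦃Q : Type⦄ [Group Q] [TopologicalSpace Q] [IsTopologicalGroup Q] (G : PSCDatum Q),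
      Ω.IsOfPSCType G → CompactSpace Q ∧ T2Space Q ∧ TotallyDisconnectedSpace Q ∧ IsEmpty G.graph.N ∧
        (∀ v, G.vertGp v = ⊤) ∧ (∃ v₀ : G.graph.V, ∀ w, w = v₀) ∧ ∃ ℓ : ℕ, ℓ.Prime ∧ G.Sigma = {ℓ} := by
    intro Q _ _ _ H hH
    obtain ⟨_, hc, ht, hd, hN, hV, hv, hS, -⟩ := hH
    exact ⟨hc, ht, hd, hN, hV, hv, hS⟩
  have hrank : UnrVertAbOfRankHolds Ω :=
    unrVertAbOfRankHolds_of_smoothCurveGenuine Ω fun Q _ _ _ G hG => by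
      obtain ⟨_, -, ht, -, hN, hV, -, -, g, r, ι, e, -, hι, hgen, hC⟩ := hG
      exact ⟨ht, hN, hV, g, r, ι, e, hι, hgen, hC⟩
  have hunr : UnrVerticialCharacterizationHolds' Ω := unrVerticialCharacterizationHolds'_of_vertGp_eq_top Ω hΩv
  have hsturdy : SturdyCoverHolds Ω :=
    sturdyCoverHolds_of_smoothCurveGenuine_singleton Ω fun Q _ _ _ G hG => by
      obtain ⟨_, hc, ht, hd, hN, hV, hv, hS, g, r, ι, e, hgr, hι, hgen, hC⟩ := hG
      exact ⟨hc, ht, hd, hN, hV, hv, hS, g, r, ι, e, hgr, hι, hgen, hC⟩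
  refine ⟨Ω, fun g r ℓ hgr hℓ => ?_, ?_, hprof, hsturdy, hrank, hunr,
    vertCountLeNodeCountSuccHolds_of_vertGp_eq_top Ω hΩv,
    vertexSetCharacterizationHolds_of_profiniteOrigin' Ω (fun Q _ _ G hG => ?_) hunr hrank, ?_,
    commensurableTerminalityHolds_of_smoothCurve' Ω hΩ₁,
    openInterDeterminesComponentHolds_of_smoothCurve' Ω (fun Q _ _ _ G hG => ?_),
    edgeLikeIncidenceHolds_of_vertGp_eq_top Ω hΩ₂,
    unrVerticialIffHolds_of_vertGp_eq_top Ω (fun Q _ _ G hG => ⟨(hΩ₂ G hG).2.1, (hΩ₂ G hG).2.2⟩),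
    graphicIffEdgeLikeVerticialHolds_of_smoothCurve' Ω hΩ₁ hΩ₂⟩
  · -- inhabitation: the pro-`ℓ` smooth curve of type `(g, r)`
    obtain ⟨Q, η, hη⟩ := exists_isProSigmaCompletion (PuncturedSurfaceGroup g r) ({ℓ} : Set ℕ)
    let T : PSCDatum Q :=
      { Sigma := {ℓ}
        sigma_prime := fun p hp => by rw [Set.mem_singleton_iff.mp hp]; exact hℓ
        sigma_nonempty := ⟨ℓ, Set.mem_singleton ℓ⟩
        graph := { V := Unit, N := Empty, C := Fin r, nodeEnds := Empty.elim, cuspEnd := fun _ => () }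
        vertGp := fun _ => ⊤
        nodeGp := Empty.elim
        cuspGp := fun i => ((cuspInertia (g := g) i).map η).topologicalClosure
        genus := fun _ => g
        isClosed_vertGp := fun _ => by rw [Subgroup.coe_top]; exact isClosed_univ
        isClosed_nodeGp := fun e => e.elim
        isClosed_cuspGp := fun _ => Subgroup.isClosed_topologicalClosure _
        nodeGp_le := fun e => e.elim
        cuspGp_le := fun _ => ⟨1, le_top⟩
        proSigma := isProSigma_of_isProSigmaCompletion hη }
    have hT : Ω.IsOfPSCType T :=
      ⟨inferInstance, inferInstance, inferInstance, inferInstance, inferInstanceAs (IsEmpty Empty),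
        fun _ => rfl, ⟨(), fun _ => rfl⟩, ⟨ℓ, hℓ, rfl⟩, g, r, η, Equiv.refl _, hgr, hη, fun _ => rfl,
        fun c => ⟨1, by rw [one_smul]; rfl⟩⟩
    exact ⟨Q, η, T, hη, hT, rfl, rfl, rfl, Fintype.card_fin r, fun _ => ⟨rfl, rfl⟩, Equiv.refl _,
      fun _ => rfl⟩
  · -- RestrictBDOfPSCTypeHolds: `restrict_smoothCurveGenuine` (same `Σ`)
    intro Q _ _ _ H hH
    obtain ⟨_, hc, ht, hd, hN, hV, ⟨v₀, hv⟩, hS, g, r, ι, e, hgr, hι, hgen, hC⟩ := hH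
    refine ⟨H.chosenBranchData, fun U _ hU => ?_⟩
    rw [restrictBD_chosen]
    haveI : CompactSpace U := isCompact_iff_compactSpace.mp (U.isClosed_of_isOpen hU).isCompact
    obtain ⟨hN', hV', hv', g', r', ι', e', h', hι', -, hgen', hC'⟩ :=
      H.restrict_smoothCurveGenuine U hU hV v₀ hv hgr ι hι e hC hgen
    exact ⟨inferInstance, inferInstance, inferInstance, inferInstance, hN', hV', hv', hS, g', r', ι', e', h',
      hι', hgen', hC'⟩
  · obtain ⟨_, hc, ht, hd, -⟩ := hG
    exact ⟨hc, ht, hd⟩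
  · -- F-2830: abc-iut-f-166's separating coverings under the relaxed cusp clause
    intro Q _ _ _ G hG
    obtain ⟨_, hc, ht, hd, hN, hV, ⟨v₀, hv⟩, -, g, r, ι, e, hgr, hι, -, hC⟩ := hG
    exact G.separatingCoverings_of_smoothCurve' G.sigma_nonempty G.sigma_prime hgr ι hι e
      (fun c => (hC c).elim fun δ h => ⟨ConjAct.ofConjAct δ, by rwa [ConjAct.toConjAct_ofConjAct]⟩)
      hV v₀ hv
  · obtain ⟨h1, h2, h3, h4, -, h6, h7⟩ := hΩ₁ G hG
    exact ⟨h1, h2, h3, h4, h6, h7⟩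

end PSCDatum

end Literature.AnabelianGeometry.SemiGraphs

end
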